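import Summits.KontsevichZagierPeriods.KontsevichZagierPeriods.Theorems.FurushoPentagonPentagonInKZCornerAssemblyAux1
import Literature.NumberTheory.Transcendental.DrinfeldAssociatorEdge
import Summits.KontsevichZagierPeriods.KontsevichZagierPeriods.Theorems.FurushoPentagonPentagonInKZHalfEdgeUniversalAlgebra

/-!
# `PentagonInKZ`, line `edge-normal-newton-leibniz`: corner assembly — aux 3 (side classes; letter densities)

Third toolkit file for the assembly step (B) of the corner principle (stub
`cornerPrinciple_assembly`, crux `PentagonInKZ`, stmt-KontsevichZagierPeriods-11348):

* end-regularised side series as classes in `P_ℚ`: the pairing with `regEnd x (ofFn U)` is a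
  finite sum over convergent word functions of the same length (`pair_regEnd_ofFn`, registered
  hook `cornerAssembly_pairRegEnd`), the SIDE CLASSES
  `Σ_{u convergent} ⟨regEnd_x (ofFn U), ofFn u⟩ · χ₀ [I (ofFn u)] ∈ P_ℚ` and their descent
  `P (ofFn U) = descendQ χ (side class)` along every realisation `χ` (`descend_sideCls`);
* the letter densities of the corner engine: horizontal `fd k t η₀` (pole letter `0`) and
  vertical `gd k ξ₀ s` (pole letter `1`) are simple-pole densities `A/(B + A t)` with rational
  data (`fd_eq`, `gd_eq`), bounded off the pole letter on the closed side by `hreg`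
  (`fd_bound`, `gd_bound`).
-/

noncomputable section

open Set MeasureTheory
open scoped TensorProduct
open Literature.NumberTheory.Transcendental
open Literature.ModelTheory.ExponentialFields (IsSemialgebraic)
open Summit.KontsevichZagierPeriods.FurushoPentagon.PentagonInKZNegative

namespace Summit.KontsevichZagierPeriods.FurushoPentagon.PentagonInKZ

namespace CornerAssembly
/-! ### End-regularised side series as classes in `P_ℚ` -/

section Series

variable {L : Type} [DecidableEq L]

/-! The *convergent word functions* of length `k` for the letter `x` are the `u : Fin k → L` whose
word `ofFn u` does not end in `x` (the support condition of `regEnd x`), the finset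
`Finset.univ.filter fun u => (List.ofFn u).getLast? ≠ some x`; the *side class* of a family of
simplex integrals `I` for the regularised letter `x` at `U : Fin k → L` is
`Σ_u ⟨regEnd_x (ofFn U), ofFn u⟩ · χ₀ [I (ofFn u)] ∈ P_ℚ`, summed over the convergent `u` — the
universal (`P_ℚ`-valued) coefficient of the end-regularised generating series. -/

/-- Membership in the finset of convergent word functions. [folklore] -/
theorem mem_conv [Fintype L] {x : L} {k : ℕ} {u : Fin k → L} :
    u ∈ (Finset.univ.filter fun u' : Fin k → _ => (List.ofFn u').getLast? ≠ some x) ↔ (List.ofFn u).getLast? ≠ some x := by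
  simp

/-- **The pairing with `regEnd x (ofFn U)` is a finite sum over convergent word functions of the
same length** (the support of `regEnd x W` consists of words with the letter counts of `W`, not
ending in `x`). [cite: IharaKanekoZagier2006, Cor. 5] -/
theorem pair_regEnd_ofFn [Fintype L] {K : Type*} [AddCommMonoid K] [Module ℚ K]
    (f : List L → K) (x : L) {k : ℕ} (U : Fin k → L) :
    Shuffle.pair f (Shuffle.regEnd x (List.ofFn U)) =
      ∑ u ∈ (Finset.univ.filter fun u' : Fin k → _ => (List.ofFn u').getLast? ≠ some x), (Shuffle.regEnd x (List.ofFn U) (List.ofFn u)) • f (List.ofFn u) := by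
  unfold Shuffle.pair
  rw [Finsupp.sum_of_support_subset _ (s := (Finset.univ.filter fun u' : Fin k → _ => (List.ofFn u').getLast? ≠ some x).image List.ofFn) ?_ _
    (fun w _ => zero_smul ℚ (f w)), Finset.sum_image fun u _ v _ h => List.ofFn_injective h]
  intro w hw
  have hlen : w.length = k := by
    have := Shuffle.length_eq_of_count_eq (Shuffle.count_eq_of_mem_support_regEnd x _ hw)
    rwa [List.length_ofFn] at this
  have hw' : List.ofFn (fun i : Fin k => w.get (Fin.cast hlen.symm i)) = w := by
    apply List.ext_getElem
    · rw [List.length_ofFn, hlen]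
    · intro i h1 h2
      simp
  rw [Finset.mem_image]
  refine ⟨fun i => w.get (Fin.cast hlen.symm i), ?_, hw'⟩
  rw [mem_conv, hw']
  exact Shuffle.getLast?_ne_of_mem_support_regEnd x _ hw

/-- **Every realisation's side series descends from the side class**: for a realisation `χ` of the
rules and its end-regularised series `P` built on the family `I` (with `I [] ≡ [pt, 1]`),
`P (ofFn U) = descendQ χ ((∑ u' ∈ Finset.univ.filter (fun u' : Fin k → _ => (List.ofFn u').getLast? ≠ some x), (Shuffle.regEnd x (List.ofFn U) (List.ofFn u')) • chiUniv (KZ.of (I (List.ofFn u')))))`. [cite: KontsevichZagier2001, §4.1] -/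
theorem descend_sideCls [Fintype L] {R : Type} [CommRing R] [Algebra ℚ R]
    (χ : KZ.FormalRep →+ R) (hχ : IsRealisation R χ) (x : L)
    (I : (w : List L) → KZ.IntegralRep w.length)
    (hI0 : KZ.of (I []) - KZ.of KZ.IntegralRep.unit ∈ KZ.relations) (P : NCSeries L R)
    (hP : ∀ W, P W = if W = [] then 1 else
      Shuffle.pair (fun w => χ (KZ.of (I w))) (Shuffle.regEnd x W))
    {k : ℕ} (U : Fin k → L) : P (List.ofFn U) = descendQ χ hχ (∑ u' ∈ Finset.univ.filter (fun u' : Fin k → _ => (List.ofFn u').getLast? ≠ some x), (Shuffle.regEnd x (List.ofFn U) (List.ofFn u')) • chiUniv (KZ.of (I (List.ofFn u')))) := by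
  have hdesc : ∀ c, descendQ χ hχ (chiUniv c) = χ c := fun c =>
    DFunLike.congr_fun (descendQ_comp_chiUniv χ hχ) c
  have hpair : Shuffle.pair (fun w => χ (KZ.of (I w))) (Shuffle.regEnd x (List.ofFn U)) =
      ∑ u ∈ (Finset.univ.filter fun u' : Fin k → _ => (List.ofFn u').getLast? ≠ some x), (Shuffle.regEnd x (List.ofFn U) (List.ofFn u)) •
        χ (KZ.of (I (List.ofFn u))) :=
    pair_regEnd_ofFn _ x U
  rw [map_sum]
  simp_rw [map_smul, hdesc]
  rw [hP, ← hpair]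
  split_ifs with h
  · rw [h, HalfEdgeUniversal.regEnd_eq_single (by simp), Shuffle.pair_single, one_smul]
    have h1 := hχ.rel _ hI0
    rw [map_sub, sub_eq_zero, chi_unit hχ] at h1
    exact h1.symm
  · rfl

omit [DecidableEq L] in
/-- A simplex family's empty word is the unit `[pt, 1]` modulo relations. [folklore] -/
theorem of_nil_sub_unit_mem (I : (w : List L) → KZ.IntegralRep w.length) (b : ℝ)
    (g : Fin ([] : List L).length → ℝ → ℝ)
    (hI : (I []).domain = {t | (∀ i, 0 < t i ∧ t i < b) ∧ StrictAnti t} ∧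
      EqOn (I []).integrand (fun t => ∏ i, g i (t i)) (I []).domain) :
    KZ.of (I []) - KZ.of KZ.IntegralRep.unit ∈ KZ.relations := by
  refine of_sub_of_unit_mem (fun t => ?_) (fun t ht => ?_)
  · rw [hI.1]
    exact ⟨fun i => i.elim0, fun i => i.elim0⟩
  · rw [hI.2 ht]
    rfl

end Series

/-! ### The dictionary of the corner engine: the letter densities `fd`, `gd` -/

section Dictionary

variable {m : ℕ} (cf : Fin (m + 2) → Fin 4 → ℚ) (α β : ℚ) (fd gd : Fin (m + 2) → ℝ → ℝ → ℝ)
  (hfd : ∀ k t y, fd k t y = ((cf k 1 : ℝ) + (cf k 3 : ℝ) * y) /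
    ((cf k 0 : ℝ) + (cf k 1 : ℝ) * t + (cf k 2 : ℝ) * y + (cf k 3 : ℝ) * t * y))
  (hgd : ∀ k x s, gd k x s = ((cf k 2 : ℝ) + (cf k 3 : ℝ) * x) /
    ((cf k 0 : ℝ) + (cf k 1 : ℝ) * x + (cf k 2 : ℝ) * s + (cf k 3 : ℝ) * x * s))
  (h0 : cf 0 = ![0, 1, 0, 0]) (h1 : cf 1 = ![0, 0, 1, 0])
  (hreg : ∀ k : Fin (m + 2), k ≠ 0 → k ≠ 1 → ∀ x y : ℝ, 0 ≤ x → x ≤ (α : ℝ) → 0 ≤ y → y ≤ (β : ℝ) →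
    (cf k 0 : ℝ) + (cf k 1 : ℝ) * x + (cf k 2 : ℝ) * y + (cf k 3 : ℝ) * x * y ≠ 0)

omit hfd hgd h0 h1 hreg in
/-- **Uniform bound for a family of simple-pole densities** `Dn k t = A_k/(B_k + A_k t)` off a pole
letter `z`: if every `k ≠ z` is dead (`A_k = 0`) or has a non-vanishing denominator on `[0, bnd]`,
one `M ≥ 0` bounds `|Dn k t|` there (continuity on a compact interval, finitely many letters).
[folklore] -/
theorem exists_bound_dens (z : Fin (m + 2)) (A B : Fin (m + 2) → ℚ) (Dn : Fin (m + 2) → ℝ → ℝ)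
    (hD : ∀ k t, Dn k t = (A k : ℝ) / ((B k : ℝ) + (A k : ℝ) * t)) (bnd : ℝ)
    (hden : ∀ k, k ≠ z → A k = 0 ∨ ∀ t, 0 ≤ t → t ≤ bnd → (B k : ℝ) + (A k : ℝ) * t ≠ 0) :
    ∃ M, 0 ≤ M ∧ ∀ k, k ≠ z → ∀ t, 0 ≤ t → t ≤ bnd → |Dn k t| ≤ M := by
  have hk : ∀ k, ∃ Mk, 0 ≤ Mk ∧ (k ≠ z → ∀ t, 0 ≤ t → t ≤ bnd → |Dn k t| ≤ Mk) := by
    intro k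
    by_cases hkz : k = z
    · exact ⟨0, le_rfl, fun h => absurd hkz h⟩
    rcases hden k hkz with hA | hB
    · refine ⟨0, le_rfl, fun _ t _ _ => ?_⟩
      rw [hD, hA, Rat.cast_zero, zero_div, abs_zero]
    · have hcont : ContinuousOn (fun t => (A k : ℝ) / ((B k : ℝ) + (A k : ℝ) * t)) (Icc 0 bnd) :=
        continuousOn_const.div (by fun_prop) fun t ht => hB t ht.1 ht.2
      obtain ⟨Mk, hMk⟩ := isCompact_Icc.exists_bound_of_continuousOn hcont
      refine ⟨max Mk 0, le_max_right _ _, fun _ t ht0 ht1 => ?_⟩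
      rw [hD]
      exact ((Real.norm_eq_abs _).symm.le.trans (hMk t ⟨ht0, ht1⟩)).trans (le_max_left _ _)
  choose Mk hMk0 hMk using hk
  refine ⟨∑ k, Mk k, Finset.sum_nonneg fun k _ => hMk0 k, fun k hkz t ht0 ht1 => ?_⟩
  exact (hMk k hkz t ht0 ht1).trans
    (Finset.single_le_sum (fun k _ => hMk0 k) (Finset.mem_univ k))

/-! #### Horizontal side: densities `t ↦ fd k t η₀` at a rational height `η₀`, pole letter `0` -/

include hfd in
/-- At a fixed height the horizontal density is `A/(B + A t)` with `A = c₁ + c₃ η₀`,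
`B = c₀ + c₂ η₀`. [folklore] -/
theorem fd_eq (η₀ : ℚ) (k : Fin (m + 2)) (t : ℝ) :
    fd k t η₀ = ((cf k 1 + cf k 3 * η₀ : ℚ) : ℝ) /
      (((cf k 0 + cf k 2 * η₀ : ℚ) : ℝ) + ((cf k 1 + cf k 3 * η₀ : ℚ) : ℝ) * t) := by
  rw [hfd]
  push_cast
  congr 1
  ring

include hfd h1 hreg in
/-- **Uniform bound of the regular horizontal densities** at a height `η₀ ∈ [0, β]` on `[0, α]`.
[folklore] -/
theorem fd_bound (η₀ : ℚ) (hη0 : 0 ≤ η₀) (hη1 : η₀ ≤ β) :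
    ∃ M, 0 ≤ M ∧ ∀ k : Fin (m + 2), k ≠ 0 → ∀ t : ℝ, 0 ≤ t → t ≤ (α : ℝ) → |fd k t η₀| ≤ M := by
  refine exists_bound_dens (0 : Fin (m + 2)) (fun k => cf k 1 + cf k 3 * η₀) (fun k => cf k 0 + cf k 2 * η₀)
    (fun k t => fd k t η₀) (fd_eq cf fd hfd η₀) α fun k hk => ?_
  by_cases hk1 : k = 1
  · left
    simp [hk1, h1]
  · right
    intro t ht0 ht1
    have := hreg k hk hk1 t η₀ ht0 ht1 (by exact_mod_cast hη0) (by exact_mod_cast hη1)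
    convert this using 1
    push_cast
    ring

/-! #### Vertical side: densities `s ↦ gd k ξ₀ s` at a rational abscissa `ξ₀`, pole letter `1` -/

include hgd in
/-- At a fixed abscissa the vertical density is `A/(B + A s)` with `A = c₂ + c₃ ξ₀`,
`B = c₀ + c₁ ξ₀`. [folklore] -/
theorem gd_eq (ξ₀ : ℚ) (k : Fin (m + 2)) (s : ℝ) :
    gd k ξ₀ s = ((cf k 2 + cf k 3 * ξ₀ : ℚ) : ℝ) /
      (((cf k 0 + cf k 1 * ξ₀ : ℚ) : ℝ) + ((cf k 2 + cf k 3 * ξ₀ : ℚ) : ℝ) * s) := by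
  rw [hgd]
  push_cast
  congr 1
  ring

include hgd h0 hreg in
/-- **Uniform bound of the regular vertical densities** at an abscissa `ξ₀ ∈ [0, α]` on `[0, β]`.
[folklore] -/
theorem gd_bound (ξ₀ : ℚ) (hξ0 : 0 ≤ ξ₀) (hξ1 : ξ₀ ≤ α) :
    ∃ M, 0 ≤ M ∧ ∀ k : Fin (m + 2), k ≠ 1 → ∀ s : ℝ, 0 ≤ s → s ≤ (β : ℝ) → |gd k ξ₀ s| ≤ M := by
  refine exists_bound_dens (1 : Fin (m + 2)) (fun k => cf k 2 + cf k 3 * ξ₀) (fun k => cf k 0 + cf k 1 * ξ₀)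
    (fun k s => gd k ξ₀ s) (gd_eq cf gd hgd ξ₀) β fun k hk => ?_
  by_cases hk0 : k = 0
  · left
    simp [hk0, h0]
  · right
    intro s hs0 hs1
    have := hreg k hk0 hk ξ₀ s (by exact_mod_cast hξ0) (by exact_mod_cast hξ1) hs0 hs1
    convert this using 1
    push_cast
    ring

end Dictionary

end CornerAssembly

open CornerAssembly in
/-- **Hook `cornerAssembly_pairRegEnd`** (registered spelling of `CornerAssembly.pair_regEnd_ofFn`):
the pairing with `regEnd x (ofFn U)` is a finite sum over the word functions of the same length not
ending in `x`. [cite: IharaKanekoZagier2006, Cor. 5] -/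
theorem cornerAssembly_pairRegEnd : ∀ (L : Type) [DecidableEq L] [Fintype L] (K : Type) [AddCommGroup K] [Module ℚ K] (f : List L → K) (x : L) (k : ℕ) (U : Fin k → L), Shuffle.pair f (Shuffle.regEnd x (List.ofFn U)) = ∑ u ∈ Finset.univ.filter (fun u : Fin k → L => (List.ofFn u).getLast? ≠ some x), (Shuffle.regEnd x (List.ofFn U) (List.ofFn u)) • f (List.ofFn u) :=
  fun _ _ _ _ _ _ f x _ U => pair_regEnd_ofFn f x U

end Summit.KontsevichZagierPeriods.FurushoPentagon.PentagonInKZ
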